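import Summits.CriticalPhenomena.Ising3D.Control2DKernelCell
import Summits.CriticalPhenomena.Ising3D.Control2DPolyCert2
import Mathlib.Topology.Order.OrderClosed
import Mathlib.Topology.Order.DenselyOrdered
import Mathlib.Topology.Algebra.Order.Field
import Mathlib.Tactic.Linarith
import Mathlib.Tactic.Positivity
import Mathlib.Tactic.FieldSimp
import Mathlib.Tactic.Ring
import HarnessLib

/-!
# Bernstein positivity decided IN the kernel by degree elevation (no coefficient literals, quadratic cost)
(cell `pub-ising3x`, seat controls-1 gen 16; KERNEL PATH for the 2D γ-certificates — CONTROL-ONLY scaffolding)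

HONEST FRAMING: lottery ticket; floor = tightest certified 3D Ising CFT bounds; no exact-solution
claim without a proof. Nothing numerical about any CFT is asserted here.

`bernCheck p q a L cs` (`Control2DPolyCert`, g15) compares `zaff q a L p` with the Bernstein form `zbern cs`
of a SUPPLIED coefficient list; `zbern` recomputes `(1-X)^{d-i}` for every `i` (cubic in the degree) and the
literal `cs` costs 40–120 KB per leaf at Λ = 11. Both break at the truncation orders the Λ = 11 box
certificates need (`Nd = 47`, degree 197: kernel memory guard). This file replaces the comparison by a
direct decision with additions only:
* `bernCoeffs a` — the unnormalised Bernstein coefficients `ĉ_i = Σ_{k≤i} C(d-k, i-k) a_k` of `Σ a_k t^k`,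
  computed by `d` degree-elevation steps `r ↦ (r ++ [a_k]) + (0 :: r)` (`bernStep`);
* the semantics WITHOUT binomials: for `t ≠ 1`, `(1-t)^{|r|-1} · r(t/(1-t))` is invariant-plus-`a_k t^k` under a
  step (`bernV_bernStep`), hence `(1-t)^d · ĉ(t/(1-t)) = a(t)` (`bernV_bernCoeffs`);
* `bernPos a := all ĉ_i ≥ 0` ⇒ `a(t) ≥ 0` on `[0,1]` (`[0,1)` by the identity and the corner test, `t = 1` by
  continuity), and `bernAuto p q a L := bernPos (zaff q a L p)` ⇒ `p ≥ 0` on `[a/q, (a+L)/q]`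
  (`evalR_nonneg_of_bernAuto`), with the cell form `cell_nonneg_of_bernAuto`.
Exact mirror: HOME/code/controls/kp3/kmirror.py (`bernCoeffs`, `bernPos`, `bernAuto`). Elementary; no facts. [folklore]
-/

namespace Summit.CriticalPhenomena.Ising3D.Control2D

open Filter Topology
open Literature.Analysis.ValidatedNumerics.PolyMP
open Literature.MathematicalPhysics.QuantumFieldTheory.ConformalBootstrap3D

/-! ### Degree elevation -/

/-- One degree-elevation step of the unnormalised Bernstein representation, adding `a · t^{m+1}`:
`(r_0, …, r_m) ↦ (r_0, r_0 + r_1, …, r_{m-1} + r_m, r_m + a)`. [folklore] -/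
def bernStep (r : List ℤ) (a : ℤ) : List ℤ := zadd (r ++ [a]) (0 :: r)

/-- Unnormalised Bernstein coefficients of `Σ a_k t^k` on `[0,1]` in degree `|a| - 1`. [folklore] -/
def bernCoeffs : List ℤ → List ℤ
  | [] => []
  | a :: as => as.foldl bernStep [a]

/-- [folklore] -/
theorem length_zadd_of_le : ∀ (u v : List ℤ), v.length ≤ u.length → (zadd u v).length = u.length
  | [], [], _ => rfl
  | [], _ :: _, h => by simp at h
  | a :: as, [], _ => rfl
  | a :: as, b :: bs, h => by
      simp only [zadd, List.length_cons, length_zadd_of_le as bs (by simpa using h)]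

/-- [folklore] -/
theorem length_bernStep (r : List ℤ) (a : ℤ) : (bernStep r a).length = r.length + 1 := by
  unfold bernStep
  rw [length_zadd_of_le _ _ (by simp)]
  simp

/-- [folklore] -/
theorem length_foldl_bernStep : ∀ (as : List ℤ) (r : List ℤ),
    (as.foldl bernStep r).length = r.length + as.length
  | [], r => by simp
  | a :: as, r => by
      rw [List.foldl_cons, length_foldl_bernStep as (bernStep r a), length_bernStep, List.length_cons]
      omega

/-- [folklore] -/
theorem evalR_castZ_append_singleton (x : ℝ) : ∀ (r : List ℤ) (a : ℤ),
    evalR (castZ (r ++ [a])) x = evalR (castZ r) x + (a : ℝ) * x ^ r.length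
  | [], a => by simp [castZ]
  | b :: bs, a => by
      rw [List.cons_append, castZ_cons, evalR_cons, evalR_castZ_append_singleton x bs a, castZ_cons,
        evalR_cons, List.length_cons, pow_succ]
      ring

/-- The rational-function reading of a coefficient list in the basis `t^i (1-t)^{m-i}` (`m = |r| - 1`), valid
for `t ≠ 1`: `(1-t)^m · r(t/(1-t))`. [folklore] -/
noncomputable def bernV (r : List ℤ) (t : ℝ) : ℝ :=
  (1 - t) ^ (r.length - 1) * evalR (castZ r) (t / (1 - t))

/-- **One elevation step adds `a t^{|r|}`** (for a non-empty `r`, `t ≠ 1`). [folklore] -/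
theorem bernV_bernStep (r : List ℤ) (hr : r ≠ []) (a : ℤ) {t : ℝ} (ht : t ≠ 1) :
    bernV (bernStep r a) t = bernV r t + (a : ℝ) * t ^ r.length := by
  obtain ⟨k, hk⟩ : ∃ k, r.length = k + 1 := ⟨r.length - 1, by
    have := List.length_pos_of_ne_nil hr; omega⟩
  have hs : (1 : ℝ) - t ≠ 0 := sub_ne_zero.mpr (Ne.symm ht)
  unfold bernV
  rw [length_bernStep, hk, bernStep, evalR_zadd, evalR_castZ_append_singleton, castZ_cons, evalR_cons, hk]
  simp only [Nat.add_sub_cancel, Int.cast_zero, zero_add]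
  rw [div_pow, pow_succ]
  field_simp
  ring

/-- **The fold adds the remaining power tail**: `V(foldl bernStep r as) = V(r) + t^{|r|} · as(t)` (`r ≠ []`,
`t ≠ 1`). [folklore] -/
theorem bernV_foldl (t : ℝ) (ht : t ≠ 1) : ∀ (as : List ℤ) (r : List ℤ), r ≠ [] →
    bernV (as.foldl bernStep r) t = bernV r t + t ^ r.length * evalR (castZ as) t
  | [], r, _ => by simp
  | a :: as, r, hr => by
      have hne : bernStep r a ≠ [] := by
        intro h; have := congrArg List.length h; rw [length_bernStep] at this; simp at this
      rw [List.foldl_cons, bernV_foldl t ht as (bernStep r a) hne, bernV_bernStep r hr a ht,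
        length_bernStep, castZ_cons, evalR_cons, pow_succ]
      ring

/-- **`(1-t)^d · ĉ(t/(1-t)) = a(t)`** for `t ≠ 1`. [folklore] -/
theorem bernV_bernCoeffs (a : List ℤ) {t : ℝ} (ht : t ≠ 1) : bernV (bernCoeffs a) t = evalR (castZ a) t := by
  cases a with
  | nil => simp [bernCoeffs, bernV]
  | cons a as =>
      rw [bernCoeffs, bernV_foldl t ht as [a] (by simp), castZ_cons, evalR_cons]
      simp [bernV, castZ]

/-- [folklore] -/
theorem length_bernCoeffs (a : List ℤ) : (bernCoeffs a).length = a.length := by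
  cases a with
  | nil => rfl
  | cons a as => rw [bernCoeffs, length_foldl_bernStep]; simp [Nat.add_comm]

/-- [folklore] -/
theorem evalR_continuous : ∀ l : List ℝ, Continuous fun x : ℝ => evalR l x
  | [] => by simpa using continuous_const
  | a :: as => continuous_const.add (continuous_id.mul (evalR_continuous as))

/-! ### The decision and its soundness -/

/-- All kernel-computed Bernstein coefficients of the list are `≥ 0`. [folklore] -/
def bernPos (a : List ℤ) : Bool := (bernCoeffs a).all fun c => decide (0 ≤ c)

/-- **Soundness of `bernPos`**: `a(t) ≥ 0` for `t ∈ [0, 1]`. PROVED (on `[0,1)` by `bernV_bernCoeffs` and the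
corner test at `t/(1-t) ≥ 0`; at `t = 1` by continuity). [folklore] -/
theorem evalR_nonneg_of_bernPos {a : List ℤ} (h : bernPos a = true) {t : ℝ} (ht0 : 0 ≤ t) (ht1 : t ≤ 1) :
    0 ≤ evalR (castZ a) t := by
  simp only [bernPos, List.all_eq_true, decide_eq_true_eq] at h
  -- `[0, 1)`
  have hlt : ∀ u : ℝ, 0 ≤ u → u < 1 → 0 ≤ evalR (castZ a) u := by
    intro u hu0 hu1
    rw [← bernV_bernCoeffs a hu1.ne, bernV]
    have h1 : (0 : ℝ) ≤ 1 - u := by linarith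
    have h2 : 0 ≤ u / (1 - u) := div_nonneg hu0 h1
    exact mul_nonneg (pow_nonneg h1 _) (evalR_nonneg_of_all_nonneg _ h h2)
  rcases lt_or_eq_of_le ht1 with hlt1 | rfl
  · exact hlt t ht0 hlt1
  · -- `t = 1` by continuity from the left
    have hcont : Tendsto (fun x : ℝ => evalR (castZ a) x) (𝓝[Set.Ioo 0 1] 1) (𝓝 (evalR (castZ a) 1)) :=
      ((evalR_continuous (castZ a)).tendsto 1).mono_left nhdsWithin_le_nhds
    have hev : ∀ᶠ x in 𝓝[Set.Ioo 0 1] (1 : ℝ), 0 ≤ evalR (castZ a) x :=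
      eventually_nhdsWithin_of_forall fun x hx => hlt x hx.1.le hx.2
    haveI : (𝓝[Set.Ioo 0 1] (1 : ℝ)).NeBot := right_nhdsWithin_Ioo_neBot zero_lt_one
    exact ge_of_tendsto hcont hev

/-- **Bernstein positivity of `p` on `[a/q, (a+L)/q]` decided in the kernel**: `bernPos (zaff q a L p)`.
[folklore] -/
def bernAuto (p : List ℤ) (q a L : ℤ) : Bool := bernPos (zaff q a L p)

/-- **Soundness of `bernAuto`**: `p(x) ≥ 0` for `a/q ≤ x ≤ (a+L)/q` (`q > 0`, `L ≥ 0`). [folklore] -/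
theorem evalR_nonneg_of_bernAuto {p : List ℤ} {q a L : ℤ} (hq : 0 < q) (hL : 0 ≤ L)
    (h : bernAuto p q a L = true) {x : ℝ} (hlo : (a : ℝ) / q ≤ x) (hhi : x ≤ ((a : ℝ) + L) / q) :
    0 ≤ evalR (castZ p) x := by
  have hqR : (0 : ℝ) < q := by exact_mod_cast hq
  obtain ⟨t, ht0, ht1, ht⟩ := exists_unitParam hq hL hlo hhi
  have key := evalR_zaff hqR.ne' a L t p
  rw [ht] at key
  have hB := evalR_nonneg_of_bernPos h ht0 ht1
  rw [key] at hB
  exact (mul_nonneg_iff_of_pos_left (pow_pos hqR _)).mp hB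

/-- **A cell of a 2D γ-certificate from the kernel's Bernstein decision** (`Δ_σ = 1/8`): if
`bernAuto (cellPolyZ wt Sl Λ ℓ Nd) q a L = true` with `q > 0`, `a ≥ 0`, `L ≥ 0`, then
`φ[F_-[Q_{Nd+1}(Δ, ℓ)]] ≥ 0` for `ℓ + 2a/q ≤ Δ ≤ ℓ + 2(a+L)/q`. [folklore] -/
theorem cell_nonneg_of_bernAuto (wt : ℕ × ℕ → ℤ) {Sl : List (ℕ × ℕ)} (hnd : Sl.Nodup) {Λ : ℕ}
    (hΛ : ∀ p ∈ Sl, p.1 + p.2 ≤ Λ) (ℓ Nd : ℕ) {q a L : ℤ} (hq : 0 < q) (ha : 0 ≤ a) (hL : 0 ≤ L)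
    (hchk : bernAuto (cellPolyZ wt Sl Λ ℓ Nd) q a L = true) {Δ : ℝ}
    (hlo : (ℓ : ℝ) + 2 * a / q ≤ Δ) (hhi : Δ ≤ (ℓ : ℝ) + 2 * ((a : ℝ) + L) / q) :
    0 ≤ taylorFunctional2D (1 / 2) Sl.toFinset (fun p => (wt p : ℝ))
      (crossF (1 / 8) (-1) (QN (Nd + 1) ℓ Δ)) := by
  have hqR : (0 : ℝ) < q := by exact_mod_cast hq
  have haq : 0 ≤ 2 * (a : ℝ) / q := by positivity
  refine cell_nonneg_of_evalR_nonneg wt hnd hΛ ℓ Nd (by linarith) ?_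
  have e1 : 2 * (a : ℝ) / q = 2 * ((a : ℝ) / q) := by ring
  have e2 : 2 * ((a : ℝ) + L) / q = 2 * (((a : ℝ) + L) / q) := by ring
  exact evalR_nonneg_of_bernAuto hq hL hchk (by linarith) (by linarith)

/-! ### Truncated coefficients: positivity is decided by the leading digits -/

/-- Floor-divide every coefficient by `10^m`. [folklore] -/
def ptrunc (p : List ℤ) (m : ℕ) : List ℤ := p.map fun c => c / (10 : ℤ) ^ m

/-- **Truncation is a lower bound on `[0, ∞)`**: `10^m · (ptrunc p m)(y) ≤ p(y)` for `y ≥ 0` (each dropped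
remainder `c mod 10^m ≥ 0` multiplies a non-negative power of `y`). [folklore] -/
theorem pow_mul_evalR_ptrunc_le (m : ℕ) {y : ℝ} (hy : 0 ≤ y) :
    ∀ p : List ℤ, (10 : ℝ) ^ m * evalR (castZ (ptrunc p m)) y ≤ evalR (castZ p) y
  | [] => by simp [ptrunc]
  | c :: cs => by
      have ih := pow_mul_evalR_ptrunc_le m hy cs
      have hM : (0 : ℤ) < (10 : ℤ) ^ m := by positivity
      have hc : (10 : ℤ) ^ m * (c / (10 : ℤ) ^ m) ≤ c := Int.mul_ediv_self_le hM.ne'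
      have hcR : (10 : ℝ) ^ m * (((c / (10 : ℤ) ^ m : ℤ)) : ℝ) ≤ c := by exact_mod_cast hc
      simp only [ptrunc, List.map_cons, castZ_cons, evalR_cons] at ih ⊢
      have hrest : y * ((10 : ℝ) ^ m * evalR (castZ (List.map (fun c => c / (10 : ℤ) ^ m) cs)) y) ≤
          y * evalR (castZ cs) y := mul_le_mul_of_nonneg_left ih hy
      nlinarith [hrest, hcR]

/-- **A cell of a 2D γ-certificate from the kernel's Bernstein decision on TRUNCATED coefficients**
(`Δ_σ = 1/8`): if `bernAuto (ptrunc (cellPolyZ wt Sl Λ ℓ Nd) m) q a L = true` with `q > 0`, `a ≥ 0`, `L ≥ 0`,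
then `φ[F_-[Q_{Nd+1}(Δ, ℓ)]] ≥ 0` for `ℓ + 2a/q ≤ Δ ≤ ℓ + 2(a+L)/q` (the cell variable `y = (Δ-ℓ)/2 ≥ 0`, so
the truncated polynomial bounds the exact one from below). Measured: the Λ = 11 cell polynomials (200–310-digit
coefficients) stay Bernstein-positive with 10–30 leading digits kept. [folklore] -/
theorem cell_nonneg_of_bernAuto_trunc (wt : ℕ × ℕ → ℤ) {Sl : List (ℕ × ℕ)} (hnd : Sl.Nodup) {Λ : ℕ}
    (hΛ : ∀ p ∈ Sl, p.1 + p.2 ≤ Λ) (ℓ Nd m : ℕ) {q a L : ℤ} (hq : 0 < q) (ha : 0 ≤ a) (hL : 0 ≤ L)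
    (hchk : bernAuto (ptrunc (cellPolyZ wt Sl Λ ℓ Nd) m) q a L = true) {Δ : ℝ}
    (hlo : (ℓ : ℝ) + 2 * a / q ≤ Δ) (hhi : Δ ≤ (ℓ : ℝ) + 2 * ((a : ℝ) + L) / q) :
    0 ≤ taylorFunctional2D (1 / 2) Sl.toFinset (fun p => (wt p : ℝ))
      (crossF (1 / 8) (-1) (QN (Nd + 1) ℓ Δ)) := by
  have hqR : (0 : ℝ) < q := by exact_mod_cast hq
  have haq : 0 ≤ 2 * (a : ℝ) / q := by positivity
  have hy : 0 ≤ (Δ - ℓ) / 2 := by linarith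
  refine cell_nonneg_of_evalR_nonneg wt hnd hΛ ℓ Nd (by linarith) ?_
  have e1 : 2 * (a : ℝ) / q = 2 * ((a : ℝ) / q) := by ring
  have e2 : 2 * ((a : ℝ) + L) / q = 2 * (((a : ℝ) + L) / q) := by ring
  have h := evalR_nonneg_of_bernAuto hq hL hchk (x := (Δ - ℓ) / 2) (by linarith) (by linarith)
  have hle := pow_mul_evalR_ptrunc_le m hy (cellPolyZ wt Sl Λ ℓ Nd)
  have hM : (0 : ℝ) < (10 : ℝ) ^ m := by positivity
  nlinarith [hle, mul_nonneg hM.le h]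

/-! ### Assembling a cell polynomial in two halves (kernel memory guard at large `Nd`) -/

/-- One term `ω_p (U^{(ℓ)}_{p₁} U^{(0)}_{p₂} + U^{(0)}_{p₁} U^{(ℓ)}_{p₂})` of the cell polynomial. [folklore] -/
def cellTermZ (wt : ℕ × ℕ → ℤ) (Λ ℓ Nd : ℕ) (p : ℕ × ℕ) : List ℤ :=
  zsmul (omegaZ Λ wt p) (zadd (zmul (uZ Nd ℓ p.1) (uZ Nd 0 p.2)) (zmul (uZ Nd 0 p.1) (uZ Nd ℓ p.2)))

/-- The cell polynomial over a part of the index list, accumulated onto `acc`. [folklore] -/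
def cellPolyAcc (wt : ℕ × ℕ → ℤ) (Sl : List (ℕ × ℕ)) (Λ ℓ Nd : ℕ) (acc : List ℤ) : List ℤ :=
  Sl.foldr (fun p acc => zadd (cellTermZ wt Λ ℓ Nd p) acc) acc

/-- [folklore] -/
theorem cellPolyZ_eq_acc (wt : ℕ × ℕ → ℤ) (Sl : List (ℕ × ℕ)) (Λ ℓ Nd : ℕ) :
    cellPolyZ wt Sl Λ ℓ Nd = cellPolyAcc wt Sl Λ ℓ Nd [] := rfl

/-- **Split of the index list**: the cell polynomial over `A ++ B` is the `A` part accumulated onto the `B`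
part (each half its own kernel decision). [folklore] -/
theorem cellPolyAcc_append (wt : ℕ × ℕ → ℤ) (A B : List (ℕ × ℕ)) (Λ ℓ Nd : ℕ) (acc : List ℤ) :
    cellPolyAcc wt (A ++ B) Λ ℓ Nd acc = cellPolyAcc wt A Λ ℓ Nd (cellPolyAcc wt B Λ ℓ Nd acc) :=
  List.foldr_append

end Summit.CriticalPhenomena.Ising3D.Control2D
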